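import Summits.BirchSwinnertonDyer.BirchSwinnertonDyer.Theorems.ResidualThetaTransportAtTwoThetaTransportResidualSchurMatrix
import Summits.BirchSwinnertonDyer.BirchSwinnertonDyer.Theorems.ResidualThetaTransportAtTwoThetaTransportResidualControl
import Summits.BirchSwinnertonDyer.BirchSwinnertonDyer.Theorems.ResidualThetaTransportAtTwoThetaTransportResidualArchimedean
import Summits.BirchSwinnertonDyer.BirchSwinnertonDyer.Theorems.ResidualThetaTransportAtTwoThetaTransportResidualCoordinates
import Summits.BirchSwinnertonDyer.BirchSwinnertonDyer.Theses.ResidualThetaTransportAtTwo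
import HarnessLib

/-!
# The transport count `#Sel_g-side[ϖ] = (#R_W)^f` (crux (R≥)ᵖ, stub `stub_transport` of line «bt26-lambda», BY NAME)

Route `ResidualThetaTransportAtTwo` (RTT), crux (R≥)ᵖ `ResidualThetaCountLowerPureAtTwo` (stmt-BirchSwinnertonDyer-26074),
line «bt26-lambda» v3; seat `prover-bsd-wall-rtt-p2` g12. HONEST FRAMING: THEOREMS ONLY (no definition, no named fact, no
instance, no `sorry`). CONDITIONAL on exactly one print binder of the route, `SerreSupersingularDecompositionImageInput`
(Serre 1972 Prop. 12, item stmt-BirchSwinnertonDyer-27793, also the 4th conjunct of PUB⁵ stmt-BirchSwinnertonDyer-27435), taken as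
the hypothesis `hSe`; nothing else is assumed. This closes the registered stub `stub_transport` of the skeleton «bt26-lambda» v3
(`Cruxes/ResidualThetaCountLowerPureAtTwo/Lines/bt26_lambda.lean`); it does NOT close the crux (stubs `stub_thetaDatum`,
`stub_cmLambdaLower` = S2 and the print binders remain). BSD is not proved by any of this.

WHAT. For the θ-datum `(n, ρ, Θ)` of the line, a uniformiser `ϖ` of `𝒪 = 𝒪_{K_g,(2)}`, and the residual isomorphism
`j : V₂^f ↪ A_g` (`V₂ = (W[2^∞])[2]`, image `A_g[ϖ]`, file `…ResidualIso`), the `g`-side counted set of the crux — classes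
`y ∈ H¹(Γ_{ℚ_∞}, A_g)` unramified outside `2S₀`, archimedean-trivial, satisfying the TRANSPORTED plus-Kummer condition at `v ∣ 2`,
and killed by `ϖ` — has exactly `(#R_W)^f` elements, `R_W` the `W`-side counted set of the crux:
* `ncard_eq_ncard_pow_of_transport` — the counting principle (an injection `push : X → Y` whose image contains `{PG}`, a coordinate
  bijection `e : X ≃ Z^f`, and `PG (push x) ↔ ∀ l, PW (e x l)` give `#{PG} = #{PW}^f`; `Nat.card_pi`, no finiteness needed);
* `transport_count` — the count, assembled from: residual control `im j_* = H¹[ϖ]`, `j_*` injective (`…ResidualControl`); the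
  unramified clauses (`…ResidualUnramified`); archimedean vacuity on `Δ_W < 0` (`…ResidualArchimedean`); coordinates
  (`…ResidualCoordinates`); the matrix of `Θ_v ∘ j` with its inverse mod `2` from local Schur (`…ResidualSchurMatrix`, the only
  use of `hSe`); and the transport of the Kummer condition (`…ResidualKummerAtTwo`);
* `Cruxes.ResidualThetaCountLowerPureAtTwo.Bt26Lambda.stub_transport` — the registered stub, by name.

References: [Kobayashi2003] Def. 1.1; [GreenbergVatsal2000] §2 p. 28; [SerreInventiones1972] §1.11 Prop. 12; [SerreGaloisCohomology1997] I §2.2.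
-/

set_option autoImplicit false
-- the Theorems namespace of this sub repeats the summit name by design (D-0017 nested layout)
set_option linter.dupNamespace false

noncomputable section

open scoped AddSubgroup
open WeierstrassCurve NumberField Field IsDedekindDomain Literature Literature.NumberTheory.EllipticCurves
  Literature.NumberTheory.EllipticCurves.GreenbergSelmer Literature.NumberTheory.EllipticCurves.GreenbergVatsal2000
  Literature.NumberTheory.GaloisRepresentations Literature.NumberTheory.EllipticCurves.Rank1Residual

namespace Summit.BirchSwinnertonDyer.BirchSwinnertonDyer.Theorems.ThetaTransport

/-! ### §1. The counting principle -/

/-- **Counting principle.** `push : X → Y` injective, a bijection `e : X → (Fin f → Z)` (inverse `einv`), every `y ∈ G` in the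
image of `push`, and `push x ∈ G ↔ ∀ l, e x l ∈ R`: then `#G = #R^f` (as `Set.ncard`; via `Nat.card_pi`, no finiteness needed). [folklore] -/
theorem ncard_eq_ncard_pow_of_transport {X Y Z : Type*} {f : ℕ} (push : X → Y) (hinj : Function.Injective push)
    (e : X → (Fin f → Z)) (einv : (Fin f → Z) → X) (he : ∀ t, e (einv t) = t) (he' : ∀ x, einv (e x) = x)
    (G : Set Y) (R : Set Z) (hrange : ∀ y ∈ G, y ∈ Set.range push) (hiff : ∀ x, push x ∈ G ↔ ∀ l, e x l ∈ R) :
    G.ncard = R.ncard ^ f := by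
  rw [← Nat.card_coe_set_eq, ← Nat.card_coe_set_eq]
  let Φ : (Fin f → ↥R) → ↥G := fun t ↦ ⟨push (einv fun l ↦ (t l : Z)), (hiff _).2 fun l ↦ by rw [he]; exact (t l).2⟩
  have hΦ : Function.Bijective Φ := by
    refine ⟨fun t t' h ↦ ?_, fun y ↦ ?_⟩
    · have h1 : (fun l ↦ (t l : Z)) = fun l ↦ (t' l : Z) := by
        rw [← he fun l ↦ (t l : Z), ← he fun l ↦ (t' l : Z), hinj (congrArg Subtype.val h)]
      exact funext fun l ↦ Subtype.ext (congr_fun h1 l)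
    · obtain ⟨x, hx⟩ := hrange y.1 y.2
      have hx' : push x ∈ G := by rw [hx]; exact y.2
      refine ⟨fun l ↦ ⟨e x l, (hiff x).1 hx' l⟩, Subtype.ext ?_⟩
      change push (einv fun l ↦ e x l) = y.1
      rw [show (fun l ↦ e x l) = e x from rfl, he', hx]
  rw [← Nat.card_congr (Equiv.ofBijective Φ hΦ), Nat.card_pi, Finset.prod_const, Finset.card_univ, Fintype.card_fin]

/-! ### §2. The transport count -/

variable (W : WeierstrassCurve ℚ) [W.IsElliptic] [W.IsGloballyMinimal] {M : ℕ}
  {g : CuspForm (CongruenceSubgroup.Gamma0 M) 2} {ι : ModularForms.coeffField g →+* PadicAlgCl 2}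

/-- **The transport count** (granted Serre 1972 Prop. 12): on the habitat (`GoodSS`, `a₂ = 0`, `Δ_W < 0`), for the θ-datum
`(n, ρ, Θ)`, a uniformiser `ϖ`, and the residual isomorphism `j : V₂^f ↪ A_g` onto `A_g[ϖ]`, the `g`-side counted set of the crux has
`(#R_W)^f` elements. [cite: Kobayashi2003, Def. 1.1] [cite: GreenbergVatsal2000, §2 p. 28] [cite: SerreInventiones1972, §1.11 Prop. 12] -/
theorem transport_count (hSe : serre1972_supersingular_decompositionSubgroup_image) (hss : GoodSS W 2)
    (ha2 : W.frobeniusTrace 2 = 0) (hΔ : W.Δ < 0) [NeZero M] (κ : ZpExtension ℚ 2)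
    (S₀ : Finset (HeightOneSpectrum (𝓞 ℚ)))
    (hMS : ∀ v : HeightOneSpectrum (𝓞 ℚ), Rat.HeightOneSpectrum.natGenerator v ∣ M → v ∈ S₀)
    (n : ℕ) (ρ : FramedGaloisRep ℚ ↥(padicCoeffIntegers (Set.range ι)) 2)
    (Θ : ∀ v : HeightOneSpectrum (𝓞 ℚ), ((2 : ℕ) : 𝓞 ℚ) ∈ v.asIdeal →
      ((Literature.NumberTheory.EllipticCurves.GreenbergSelmer.Cofree ρ ↥(Literature.NumberTheory.EllipticCurves.padicCoeffField (Set.range ι))) ≃+ (Fin n → ↥(W.geomPrimaryTorsion 2))))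
    (hρ : ∀ v : HeightOneSpectrum (𝓞 ℚ), ¬ Rat.HeightOneSpectrum.natGenerator v ∣ 2 * M → FramedGaloisRep.IsUnramifiedAt v ρ)
    (hΘ : ∀ (v : HeightOneSpectrum (𝓞 ℚ)) (hv : ((2 : ℕ) : 𝓞 ℚ) ∈ v.asIdeal) (δ : absoluteGaloisGroup (v.adicCompletion ℚ))
      (m : (Literature.NumberTheory.EllipticCurves.GreenbergSelmer.Cofree ρ ↥(Literature.NumberTheory.EllipticCurves.padicCoeffField (Set.range ι)))) (i : Fin n), Θ v hv ((resGalOfEmb (closureEmb (K := ℚ) (v.adicCompletion ℚ)) δ) • m) i =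
        (resGalOfEmb (closureEmb (K := ℚ) (v.adicCompletion ℚ)) δ) • (Θ v hv m i))
    {ϖ : ↥(padicCoeffIntegers (Set.range ι))} (hϖ : Irreducible ϖ) (f : ℕ)
    (j : (Fin f → ↥(AddSubgroup.torsionBy ↥(W.geomPrimaryTorsion 2) (2 : ℤ))) →+ (Literature.NumberTheory.EllipticCurves.GreenbergSelmer.Cofree ρ ↥(Literature.NumberTheory.EllipticCurves.padicCoeffField (Set.range ι)))) (hjinj : Function.Injective j)
    (hjsmul : ∀ (σ : absoluteGaloisGroup ℚ) (x : Fin f → ↥(AddSubgroup.torsionBy ↥(W.geomPrimaryTorsion 2) (2 : ℤ))), j (σ • x) = σ • j x)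
    (hjrange : Set.range j = {a | ϖ • a = 0}) :
    {y : Literature.NumberTheory.EllipticCurves.subgroupH1 κ.kerSubgroup (Literature.NumberTheory.EllipticCurves.GreenbergSelmer.Cofree ρ ↥(Literature.NumberTheory.EllipticCurves.padicCoeffField (Set.range ι))) | y ∈ Literature.NumberTheory.EllipticCurves.GreenbergVatsal2000.unramifiedOutside κ.kerSubgroup (Literature.NumberTheory.EllipticCurves.GreenbergSelmer.Cofree ρ ↥(Literature.NumberTheory.EllipticCurves.padicCoeffField (Set.range ι))) 2 (↑S₀ : Set (IsDedekindDomain.HeightOneSpectrum (NumberField.RingOfIntegers ℚ))) ∧ (∀ (w : NumberField.InfinitePlace ℚ) (σ : Field.absoluteGaloisGroup ℚ), Literature.NumberTheory.EllipticCurves.conjH1 κ.kerSubgroup (Literature.NumberTheory.EllipticCurves.GreenbergSelmer.Cofree ρ ↥(Literature.NumberTheory.EllipticCurves.padicCoeffField (Set.range ι))) σ y ∈ Literature.NumberTheory.EllipticCurves.GreenbergSelmer.infKer κ.kerSubgroup (Literature.NumberTheory.EllipticCurves.GreenbergSelmer.Cofree ρ ↥(Literature.NumberTheory.EllipticCurves.padicCoeffField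 (Set.range ι))) w) ∧ (∀ (v : IsDedekindDomain.HeightOneSpectrum (NumberField.RingOfIntegers ℚ)) (hv : ((2 : ℕ) : NumberField.RingOfIntegers ℚ) ∈ v.asIdeal) (σ : Field.absoluteGaloisGroup ℚ), ∃ (φ : ↥(Literature.NumberTheory.GaloisRepresentations.contOneCocycles (Literature.NumberTheory.EllipticCurves.discreteTopRep ↥κ.kerSubgroup (Literature.NumberTheory.EllipticCurves.GreenbergSelmer.Cofree ρ ↥(Literature.NumberTheory.EllipticCurves.padicCoeffField (Set.range ι)))))) (Q : Fin n → Literature.NumberTheory.EllipticCurves.localPoints W (v.adicCompletion ℚ)) (k : ℕ), Literature.NumberTheory.GaloisRepresentations.oneCocycleClass (Literature.NumberTheory.EllipticCurves.discreteTopRep ↥κ.kerSubgroup (Literature.NumberTheory.EllipticCurves.GreenbergSelmer.Cofree ρ ↥(Literature.NumberTheory.EllipticCurves.padicCoeffField (Set.range ι)))) φ = Literature.NumberTheory.EllipticCurves.conjH1 κ.kerSubgroup (Literature.NumberTheory.EllipticCurves.GreenbergSelmer.Cofree ρ ↥(Literature.NumberTheory.EllipticCurves.padicCoeffField (Set.range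 ι))) σ y ∧ (∀ i : Fin n, (2 ^ k) • Q i ∈ ⨆ m : ℕ, Literature.NumberTheory.EllipticCurves.Kobayashi2003.signedLocalPoints κ (v.adicCompletion ℚ) W 1 m) ∧ ∀ (τ : ↥(Literature.NumberTheory.EllipticCurves.localSubgroupOfEmb κ.kerSubgroup (Literature.NumberTheory.EllipticCurves.closureEmb (K := ℚ) (v.adicCompletion ℚ)))) (i : Fin n), Literature.NumberTheory.EllipticCurves.pointsMapOfEmb W (Literature.NumberTheory.EllipticCurves.closureEmb (K := ℚ) (v.adicCompletion ℚ)) (((Θ v hv (φ.1 (Literature.NumberTheory.EllipticCurves.resGalSubgroupOfEmb κ.kerSubgroup (Literature.NumberTheory.EllipticCurves.closureEmb (K := ℚ) (v.adicCompletion ℚ)) τ))) i : ↥(W.geomPrimaryTorsion 2)) : W.geomPoints) = (τ : Field.absoluteGaloisGroup (v.adicCompletion ℚ)) • Q i - Q i) ∧ Literature.NumberTheory.EllipticCurves.GreenbergSelmer.scalarH1 κ.kerSubgroup (Literature.NumberTheory.EllipticCurves.GreenbergSelmer.Cofree ρ ↥(Literature.NumberTheory.EllipticCurves.padicCoeffField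 (Set.range ι))) ϖ y = 0}.ncard =
      {x : Literature.NumberTheory.EllipticCurves.subgroupH1 κ.kerSubgroup ↥(AddSubgroup.torsionBy ↥(W.geomPrimaryTorsion 2) (2 : ℤ)) | x ∈ Literature.NumberTheory.EllipticCurves.GreenbergVatsal2000.unramifiedOutside κ.kerSubgroup ↥(AddSubgroup.torsionBy ↥(W.geomPrimaryTorsion 2) (2 : ℤ)) 2 (↑S₀ : Set (IsDedekindDomain.HeightOneSpectrum (NumberField.RingOfIntegers ℚ))) ∧ (∀ (w : NumberField.InfinitePlace ℚ) (σ : Field.absoluteGaloisGroup ℚ), Literature.NumberTheory.EllipticCurves.conjH1 κ.kerSubgroup ↥(AddSubgroup.torsionBy ↥(W.geomPrimaryTorsion 2) (2 : ℤ)) σ x ∈ Literature.NumberTheory.EllipticCurves.GreenbergSelmer.infKer κ.kerSubgroup ↥(AddSubgroup.torsionBy ↥(W.geomPrimaryTorsion 2) (2 : ℤ)) w) ∧ (∀ (v : IsDedekindDomain.HeightOneSpectrum (NumberField.RingOfIntegers ℚ)), ((2 : ℕ) : NumberField.RingOfIntegers ℚ) ∈ v.asIdeal → ∀ σ : Field.absoluteGaloisGroup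 ℚ, W.conjH1 2 κ.kerSubgroup σ (Literature.NumberTheory.EllipticCurves.GreenbergVatsal2000.pushH1 κ.kerSubgroup (AddSubgroup.torsionBy ↥(W.geomPrimaryTorsion 2) (2 : ℤ)).subtype (fun _ _ ↦ rfl) x) ∈ Literature.NumberTheory.EllipticCurves.Kobayashi2003.localKummerOverOfEmb W 2 κ.kerSubgroup (Literature.NumberTheory.EllipticCurves.closureEmb (K := ℚ) (v.adicCompletion ℚ)) (⨆ n : ℕ, Literature.NumberTheory.EllipticCurves.Kobayashi2003.signedLocalPoints κ (v.adicCompletion ℚ) W 1 n))}.ncard ^ f := by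
  refine (exists_coordEquiv κ.kerSubgroup ↥(AddSubgroup.torsionBy ↥(W.geomPrimaryTorsion 2) (2 : ℤ)) f).elim fun e he ↦ ?_
  have hecoc := he.1
  have heconj := he.2.1
  have heunr := he.2.2.1
  refine ncard_eq_ncard_pow_of_transport (pushH1 κ.kerSubgroup j hjsmul)
    (pushH1_residual_injective W hss κ ρ hϖ j hjinj hjsmul hjrange) e e.symm e.apply_symm_apply e.symm_apply_apply _ _
    ?_ ?_
  · intro y hy
    rw [Set.mem_setOf_eq] at hy
    exact (mem_range_pushH1_residual_iff W κ ρ hϖ j hjinj hjsmul hjrange y).2 hy.2.2.2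
  intro x
  rw [Set.mem_setOf_eq]
  simp only [Set.mem_setOf_eq]
  constructor
  · intro hG l
    have hunr := hG.1
    have hat2 := hG.2.2.1
    refine ⟨?_, fun w σ ↦ ?_, fun v hv σ ↦ ?_⟩
    · exact (mem_unramifiedOutside_pi_iff κ.kerSubgroup ↥(AddSubgroup.torsionBy ↥(W.geomPrimaryTorsion 2) (2 : ℤ)) f 2 _ e heconj heunr x).1
        ((mem_unramifiedOutside_iff_pushH1_residual_mem W κ S₀ hMS ρ hρ j hjinj hjsmul x).2 hunr) l
    · rw [infKer, AddMonoidHom.mem_ker]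
      exact subgroupH1_inf_decompInf_eq_zero W hΔ _ w _
    · exact (exists_matrix_theta_comp W hSe hss ha2 v hv (Θ v hv) (hΘ v hv) j hjinj hjsmul).elim fun B hB0 ↦
        hB0.elim fun B' hBB ↦ ((kummer_transport_conj_iff W κ.kerSubgroup (closureEmb (K := ℚ) (v.adicCompletion ℚ)) _
          (Θ v hv) j B B' e (hΘ v hv) hjsmul hBB.1 hBB.2 hecoc heconj x σ).1 (hat2 v hv σ)) l
  · intro hW
    refine ⟨?_, fun w σ ↦ conjH1_pushH1_residual_mem_infKer W hΔ κ.kerSubgroup j hjsmul x σ w, fun v hv σ ↦ ?_,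
      (mem_range_pushH1_residual_iff W κ ρ hϖ j hjinj hjsmul hjrange _).1 ⟨x, rfl⟩⟩
    · exact (mem_unramifiedOutside_iff_pushH1_residual_mem W κ S₀ hMS ρ hρ j hjinj hjsmul x).1
        ((mem_unramifiedOutside_pi_iff κ.kerSubgroup ↥(AddSubgroup.torsionBy ↥(W.geomPrimaryTorsion 2) (2 : ℤ)) f 2 _ e heconj heunr x).2 fun l ↦ (hW l).1)
    · exact (exists_matrix_theta_comp W hSe hss ha2 v hv (Θ v hv) (hΘ v hv) j hjinj hjsmul).elim fun B hB0 ↦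
        hB0.elim fun B' hBB ↦ (kummer_transport_conj_iff W κ.kerSubgroup (closureEmb (K := ℚ) (v.adicCompletion ℚ)) _
          (Θ v hv) j B B' e (hΘ v hv) hjsmul hBB.1 hBB.2 hecoc heconj x σ).2 fun l ↦ (hW l).2.2 v hv σ

end Summit.BirchSwinnertonDyer.BirchSwinnertonDyer.Theorems.ThetaTransport

/-! ### §3. The registered stub, by name -/

namespace Summit.BirchSwinnertonDyer.BirchSwinnertonDyer.Cruxes.ResidualThetaCountLowerPureAtTwo.Bt26Lambda

/-- **Stub `stub_transport` of line «bt26-lambda» (v3, lean binder list, term-level `open … in`), BY NAME**: granted the route's print binder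
`SerreSupersingularDecompositionImageInput` (Serre 1972 Prop. 12), the `g`-side counted set `#Sel-side[ϖ]` of the crux equals
`(#R_W)^f` (`ThetaTransport.transport_count`). [cite: Kobayashi2003, Def. 1.1] [cite: SerreInventiones1972, §1.11 Prop. 12] -/
theorem stub_transport : open Literature.NumberTheory.EllipticCurves GreenbergSelmer GreenbergVatsal2000 Kobayashi2003 ModularForms Rank1Residual Literature.NumberTheory.GaloisRepresentations IsDedekindDomain NumberField Field Rat.HeightOneSpectrum in Summit.BirchSwinnertonDyer.BirchSwinnertonDyer.Theses.ResidualThetaTransportAtTwo.SerreSupersingularDecompositionImageInput → ∀ (W : WeierstrassCurve ℚ) [W.IsElliptic] [W.IsGloballyMinimal], GoodSS W 2 → W.frobeniusTrace 2 = 0 → W.Δ < 0 → ∀ (M : ℕ) [NeZero M] (g : CuspForm (CongruenceSubgroup.Gamma0 M) 2) (ι : coeffField g →+* PadicAlgCl 2) (κ : ZpExtension ℚ 2) (S₀ : Finset (HeightOneSpectrum (RingOfIntegers ℚ))), (∀ v : HeightOneSpectrum (RingOfIntegers ℚ), natGenerator v ∣ M → v ∈ S₀) → ∀ (n : ℕ)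 (ρ : FramedGaloisRep ℚ ↥(padicCoeffIntegers (Set.range ι)) 2) (Θ : (∀ v : HeightOneSpectrum (RingOfIntegers ℚ), ((2 : ℕ) : RingOfIntegers ℚ) ∈ v.asIdeal → ((Cofree ρ ↥(padicCoeffField (Set.range ι))) ≃+ (Fin n → ↥(W.geomPrimaryTorsion 2))))), (∀ v : HeightOneSpectrum (RingOfIntegers ℚ), ¬ natGenerator v ∣ 2 * M → FramedGaloisRep.IsUnramifiedAt v ρ) → (∀ (v : HeightOneSpectrum (RingOfIntegers ℚ)) (hv : ((2 : ℕ) : RingOfIntegers ℚ) ∈ v.asIdeal) (δ : absoluteGaloisGroup (v.adicCompletion ℚ)) (m : (Cofree ρ ↥(padicCoeffField (Set.range ι)))) (i : Fin n), Θ v hv ((resGalOfEmb (closureEmb (K := ℚ) (v.adicCompletion ℚ)) δ) • m) i = (resGalOfEmb (closureEmb (K := ℚ) (v.adicCompletion ℚ)) δ) • (Θ v hv m i)) → ∀ (ϖ : ↥(padicCoeffIntegers (Set.range ι))), Irreducible ϖ → ∀ (f : ℕ) (j : (Fin f → ↥(AddSubgroup.torsionBy ↥(W.geomPrimaryTorsion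 2) (2 : ℤ))) →+ Cofree ρ ↥(padicCoeffField (Set.range ι))), Function.Injective j → (∀ (σ : absoluteGaloisGroup ℚ) (x : Fin f → ↥(AddSubgroup.torsionBy ↥(W.geomPrimaryTorsion 2) (2 : ℤ))), j (σ • x) = σ • j x) → Set.range j = {a | ϖ • a = 0} → {y : subgroupH1 κ.kerSubgroup (Cofree ρ ↥(padicCoeffField (Set.range ι))) | y ∈ unramifiedOutside κ.kerSubgroup (Cofree ρ ↥(padicCoeffField (Set.range ι))) 2 ↑S₀ ∧ (∀ w σ, conjH1 κ.kerSubgroup (Cofree ρ ↥(padicCoeffField (Set.range ι))) σ y ∈ infKer κ.kerSubgroup (Cofree ρ ↥(padicCoeffField (Set.range ι))) w) ∧ (∀ (v : HeightOneSpectrum (RingOfIntegers ℚ)) (hv : ((2 : ℕ) : RingOfIntegers ℚ) ∈ v.asIdeal) (σ : absoluteGaloisGroup ℚ), ∃ (φ : _) (Q : Fin n → localPoints W (v.adicCompletion ℚ)) (k : ℕ), oneCocycleClass (discreteTopRep ↥κ.kerSubgroup (Cofree ρ ↥(padicCoeffField (Set.range ι)))) φ = conjH1 κ.kerSubgroup (Cofree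 ρ ↥(padicCoeffField (Set.range ι))) σ y ∧ (∀ i, (2 ^ k) • Q i ∈ ⨆ m : ℕ, signedLocalPoints κ (v.adicCompletion ℚ) W 1 m) ∧ ∀ τ i, pointsMapOfEmb W (closureEmb (K := ℚ) (v.adicCompletion ℚ)) (((Θ v hv (φ.1 (resGalSubgroupOfEmb κ.kerSubgroup (closureEmb (K := ℚ) (v.adicCompletion ℚ)) τ))) i : ↥(W.geomPrimaryTorsion 2)) : W.geomPoints) = (τ : absoluteGaloisGroup (v.adicCompletion ℚ)) • Q i - Q i) ∧ scalarH1 κ.kerSubgroup (Cofree ρ ↥(padicCoeffField (Set.range ι))) ϖ y = 0}.ncard = {x : subgroupH1 κ.kerSubgroup ↥(AddSubgroup.torsionBy ↥(W.geomPrimaryTorsion 2) (2 : ℤ)) | x ∈ unramifiedOutside κ.kerSubgroup ↥(AddSubgroup.torsionBy ↥(W.geomPrimaryTorsion 2) (2 : ℤ)) 2 ↑S₀ ∧ (∀ w σ, conjH1 κ.kerSubgroup ↥(AddSubgroup.torsionBy ↥(W.geomPrimaryTorsion 2) (2 : ℤ)) σ x ∈ infKer κ.kerSubgroup ↥(AddSubgroup.torsionBy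 ↥(W.geomPrimaryTorsion 2) (2 : ℤ)) w) ∧ (∀ (v : HeightOneSpectrum (RingOfIntegers ℚ)), ((2 : ℕ) : RingOfIntegers ℚ) ∈ v.asIdeal → ∀ σ : absoluteGaloisGroup ℚ, W.conjH1 2 κ.kerSubgroup σ (pushH1 κ.kerSubgroup (AddSubgroup.torsionBy ↥(W.geomPrimaryTorsion 2) (2 : ℤ)).subtype (fun _ _ ↦ rfl) x) ∈ localKummerOverOfEmb W 2 κ.kerSubgroup (closureEmb (K := ℚ) (v.adicCompletion ℚ)) (⨆ n : ℕ, signedLocalPoints κ (v.adicCompletion ℚ) W 1 n))}.ncard ^ f := by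
  intro hSe W _ _ hss ha2 hΔ M _ g ι κ S₀ hMS n ρ Θ hρ hΘ ϖ hϖ f j hjinj hjsmul hjrange
  exact Summit.BirchSwinnertonDyer.BirchSwinnertonDyer.Theorems.ThetaTransport.transport_count W hSe hss ha2 hΔ κ S₀ hMS n ρ Θ
    hρ hΘ hϖ f j hjinj hjsmul hjrange

end Summit.BirchSwinnertonDyer.BirchSwinnertonDyer.Cruxes.ResidualThetaCountLowerPureAtTwo.Bt26Lambda

end
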